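import Mathlib

/-!
# The flow-weighted level-one inequality (U) is closed under series and parallel composition
(seat mine-b, cell pub-perc-repro2; conjectures/MINE-B.md §18)

Two-colour pattern language (MINE-B.md §10, §17): a pattern `(O, Y)` of a two-terminal graph with a
colouring `γ ⊆ Y` (blue `O ∪ γ`, red `O ∪ (Y ∖ γ)`) has the red and blue `s–t` max-flows `F_R, F_B`;
`N(i, b) = #{γ : F_R = i, F_B = b}` is its joint law, colour-swap symmetric.  The statement

  **(U)**   `#{F_R = 1} ≥ Σ_{γ : F_R = 0} F_B(γ)`,   i.e. `Σ_b N(1, b) ≥ Σ_a a · N(0, a)`,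

is the level-summed form of the `i = 0` rows of QSTEP (it strengthens `H(1,1) ≥ 2·H(0,2)` by
`Σ_{a ≥ 3} H(0, a)`, MINE-B.md §18).  Here we work with **weighted state families**: a finite index
type `ι` (the configurations), weights `w` (the counting measure, or any product weights), and the two
levels `r = F_R`, `b = F_B`.  Parallel composition of two-terminal networks adds the flows and series
composition takes minima, on the product of the configuration sets; so

* `uval_par` — **(U) is exactly additive under parallel composition**:
  `U(F₁ ∥ F₂) = U(F₁)·Z(F₂) + Z(F₁)·U(F₂)` with `Z = Σ w·[r = 0]` (no symmetry needed);
* `uval_ser_nonneg` — **(U) is preserved by series composition of symmetric families**: write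
  `U = U′ = Σ w·([r = 1 ∧ b ≥ 1] − [b = 0 ∧ r ≥ 2]·r)` (`uval_eq_uval'`, the colour swap moves the
  axis terms); the positive part of `U′(F₁ · F₂)` is `B₁B₂ + B₁Q₂ + Q₁B₂` and the negative part is at
  most `A₁Q₂ + Q₁A₂ + A₁A₂/2` (`B` = mass of `{r = 1, b ≥ 1}`, `Q` = mass of `{r ≥ 2, b ≥ 1}`,
  `A` = `r`-weighted mass of `{r ≥ 2, b = 0}`, `A ≤ B` by (U) of the parts);
* `symm_par`, `symm_ser` — the swap symmetry is inherited by both products;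
* `SP.uval_nonneg` — hence **(U) holds for every symmetric family built from the atoms by
  the two products**, in particular for the uniform two-colouring of every pattern `(O, Y)` of every
  series–parallel two-terminal network (atoms: a free edge `{(1,0), (0,1)}`, a pinned edge `{(1,1)}`,
  an absent edge `{(0,0)}`).
-/

namespace Summit.Ventures.PercRepro2

namespace FlowSum

open Finset

variable {ι : Type*} [Fintype ι]

/-- `U(F) = Σ_x w x · ([r x = 1] − [r x = 0] · b x)`: the weight of red level `1` minus the blue-flow
weighted weight of red level `0`. -/
def uval (w : ι → ℝ) (r b : ι → ℕ) : ℝ :=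
  ∑ x, w x * ((if r x = 1 then (1 : ℝ) else 0) - (if r x = 0 then (b x : ℝ) else 0))

/-- `Z(F) = Σ_x w x · [r x = 0]`: the weight of red level `0`. -/
def zval (w : ι → ℝ) (r : ι → ℕ) : ℝ := ∑ x, w x * (if r x = 0 then (1 : ℝ) else 0)

/-- `U′(F) = Σ_x w x · ([r x = 1 ∧ b x ≥ 1] − [b x = 0 ∧ r x ≥ 2] · r x)`: the form of `U` with the axis
terms moved by the colour swap. -/
def uval' (w : ι → ℝ) (r b : ι → ℕ) : ℝ :=
  ∑ x, w x * ((if r x = 1 ∧ 1 ≤ b x then (1 : ℝ) else 0)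
    - (if b x = 0 ∧ 2 ≤ r x then (r x : ℝ) else 0))

/-- colour-swap symmetry of a weighted family: a weight-preserving bijection exchanging the levels -/
def Symm (w : ι → ℝ) (r b : ι → ℕ) : Prop :=
  ∃ σ : ι ≃ ι, ∀ x, w (σ x) = w x ∧ r (σ x) = b x ∧ b (σ x) = r x

/-- `U = U′` for symmetric families -/
theorem uval_eq_uval' {w : ι → ℝ} {r b : ι → ℕ} (hs : Symm w r b) : uval w r b = uval' w r b := by
  obtain ⟨σ, hσ⟩ := hs
  -- the two swapped sums
  have e1 : ∑ x, w x * (if r x = 1 ∧ b x = 0 then (1 : ℝ) else 0)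
      = ∑ x, w x * (if r x = 0 ∧ b x = 1 then (1 : ℝ) else 0) := by
    rw [← Equiv.sum_comp σ (fun x => w x * (if r x = 0 ∧ b x = 1 then (1 : ℝ) else 0))]
    refine Finset.sum_congr rfl (fun x _ => ?_)
    obtain ⟨h1, h2, h3⟩ := hσ x
    rw [h1, h2, h3]
    simp only [and_comm]
  have e2 : ∑ x, w x * (if r x = 0 ∧ 2 ≤ b x then (b x : ℝ) else 0)
      = ∑ x, w x * (if b x = 0 ∧ 2 ≤ r x then (r x : ℝ) else 0) := by
    rw [← Equiv.sum_comp σ (fun x => w x * (if b x = 0 ∧ 2 ≤ r x then (r x : ℝ) else 0))]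
    refine Finset.sum_congr rfl (fun x _ => ?_)
    obtain ⟨h1, h2, h3⟩ := hσ x
    rw [h1, h2, h3]
  -- pointwise decomposition of `U`
  have key : ∀ x, w x * ((if r x = 1 then (1 : ℝ) else 0) - (if r x = 0 then (b x : ℝ) else 0))
      = w x * (if r x = 1 ∧ 1 ≤ b x then (1 : ℝ) else 0)
        + w x * (if r x = 1 ∧ b x = 0 then (1 : ℝ) else 0)
        - w x * (if r x = 0 ∧ b x = 1 then (1 : ℝ) else 0)
        - w x * (if r x = 0 ∧ 2 ≤ b x then (b x : ℝ) else 0) := by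
    intro x
    split_ifs <;> first | (exfalso; omega) | (simp_all <;> first | ring1 | omega)
  unfold uval uval'
  rw [Finset.sum_congr rfl (fun x _ => key x)]
  simp only [Finset.sum_sub_distrib, Finset.sum_add_distrib, mul_sub]
  rw [e1, e2]
  ring

/-! ### Parallel composition: flows add -/

/-- the parallel product of two families on `ι₁ × ι₂` -/
theorem uval_par {ι₁ ι₂ : Type*} [Fintype ι₁] [Fintype ι₂] (w₁ : ι₁ → ℝ) (r₁ b₁ : ι₁ → ℕ)
    (w₂ : ι₂ → ℝ) (r₂ b₂ : ι₂ → ℕ) :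
    uval (fun p : ι₁ × ι₂ => w₁ p.1 * w₂ p.2) (fun p => r₁ p.1 + r₂ p.2) (fun p => b₁ p.1 + b₂ p.2)
      = uval w₁ r₁ b₁ * zval w₂ r₂ + zval w₁ r₁ * uval w₂ r₂ b₂ := by
  unfold uval zval
  rw [Fintype.sum_prod_type, Finset.sum_mul_sum, Finset.sum_mul_sum, ← Finset.sum_add_distrib]
  refine Finset.sum_congr rfl (fun x _ => ?_)
  rw [← Finset.sum_add_distrib]
  refine Finset.sum_congr rfl (fun y _ => ?_)
  -- pointwise identity: split all the `if`s, every consistent case is a ring identity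
  push_cast
  split_ifs <;> first | ring1 | (exfalso; omega)

/-- the swap symmetry of the parallel product -/
theorem symm_par {ι₁ ι₂ : Type*} [Fintype ι₁] [Fintype ι₂] {w₁ : ι₁ → ℝ} {r₁ b₁ : ι₁ → ℕ}
    {w₂ : ι₂ → ℝ} {r₂ b₂ : ι₂ → ℕ} (h₁ : Symm w₁ r₁ b₁) (h₂ : Symm w₂ r₂ b₂) :
    Symm (fun p : ι₁ × ι₂ => w₁ p.1 * w₂ p.2) (fun p => r₁ p.1 + r₂ p.2)
      (fun p => b₁ p.1 + b₂ p.2) := by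
  obtain ⟨σ₁, hσ₁⟩ := h₁
  obtain ⟨σ₂, hσ₂⟩ := h₂
  refine ⟨Equiv.prodCongr σ₁ σ₂, fun p => ?_⟩
  obtain ⟨a1, a2, a3⟩ := hσ₁ p.1
  obtain ⟨c1, c2, c3⟩ := hσ₂ p.2
  simp only [Equiv.prodCongr_apply, Prod.map_fst, Prod.map_snd]
  exact ⟨by rw [a1, c1], by rw [a2, c2], by rw [a3, c3]⟩

/-- the swap symmetry of the series product -/
theorem symm_ser {ι₁ ι₂ : Type*} [Fintype ι₁] [Fintype ι₂] {w₁ : ι₁ → ℝ} {r₁ b₁ : ι₁ → ℕ}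
    {w₂ : ι₂ → ℝ} {r₂ b₂ : ι₂ → ℕ} (h₁ : Symm w₁ r₁ b₁) (h₂ : Symm w₂ r₂ b₂) :
    Symm (fun p : ι₁ × ι₂ => w₁ p.1 * w₂ p.2) (fun p => min (r₁ p.1) (r₂ p.2))
      (fun p => min (b₁ p.1) (b₂ p.2)) := by
  obtain ⟨σ₁, hσ₁⟩ := h₁
  obtain ⟨σ₂, hσ₂⟩ := h₂
  refine ⟨Equiv.prodCongr σ₁ σ₂, fun p => ?_⟩
  obtain ⟨a1, a2, a3⟩ := hσ₁ p.1
  obtain ⟨c1, c2, c3⟩ := hσ₂ p.2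
  simp only [Equiv.prodCongr_apply, Prod.map_fst, Prod.map_snd]
  exact ⟨by rw [a1, c1], by rw [a2, c2], by rw [a3, c3]⟩

/-! ### Series composition: flows take minima -/

/-- the positive part of `U′` of a series product, pointwise -/
theorem ser_pos_pointwise (w₁ w₂ : ℝ) (r₁ b₁ r₂ b₂ : ℕ) :
    w₁ * w₂ * (if min r₁ r₂ = 1 ∧ 1 ≤ min b₁ b₂ then (1 : ℝ) else 0)
      = w₁ * (if r₁ = 1 ∧ 1 ≤ b₁ then (1 : ℝ) else 0) * (w₂ * (if r₂ = 1 ∧ 1 ≤ b₂ then (1 : ℝ) else 0))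
        + w₁ * (if r₁ = 1 ∧ 1 ≤ b₁ then (1 : ℝ) else 0) * (w₂ * (if 1 ≤ b₂ ∧ 2 ≤ r₂ then (1 : ℝ) else 0))
        + w₁ * (if 1 ≤ b₁ ∧ 2 ≤ r₁ then (1 : ℝ) else 0) * (w₂ * (if r₂ = 1 ∧ 1 ≤ b₂ then (1 : ℝ) else 0)) := by
  split_ifs <;> first | ring1 | (exfalso; omega)

/-- the negative part of `U′` of a series product, pointwise bound -/
theorem ser_neg_pointwise (w₁ w₂ : ℝ) (hw₁ : 0 ≤ w₁) (hw₂ : 0 ≤ w₂) (r₁ b₁ r₂ b₂ : ℕ) :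
    w₁ * w₂ * (if min b₁ b₂ = 0 ∧ 2 ≤ min r₁ r₂ then ((min r₁ r₂ : ℕ) : ℝ) else 0)
      ≤ w₁ * (if b₁ = 0 ∧ 2 ≤ r₁ then (r₁ : ℝ) else 0) * (w₂ * (if 1 ≤ b₂ ∧ 2 ≤ r₂ then (1 : ℝ) else 0))
        + w₁ * (if 1 ≤ b₁ ∧ 2 ≤ r₁ then (1 : ℝ) else 0) * (w₂ * (if b₂ = 0 ∧ 2 ≤ r₂ then (r₂ : ℝ) else 0))
        + w₁ * (if b₁ = 0 ∧ 2 ≤ r₁ then (r₁ : ℝ) else 0) * (w₂ * (if b₂ = 0 ∧ 2 ≤ r₂ then (1 : ℝ) else 0)) := by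
  have hw : 0 ≤ w₁ * w₂ := mul_nonneg hw₁ hw₂
  have hmin1 : ((min r₁ r₂ : ℕ) : ℝ) ≤ r₁ := by exact_mod_cast min_le_left r₁ r₂
  have hmin2 : ((min r₁ r₂ : ℕ) : ℝ) ≤ r₂ := by exact_mod_cast min_le_right r₁ r₂
  have hmin0 : (0 : ℝ) ≤ ((min r₁ r₂ : ℕ) : ℝ) := Nat.cast_nonneg _
  have hr1 : (0 : ℝ) ≤ r₁ := Nat.cast_nonneg _
  have hr2 : (0 : ℝ) ≤ r₂ := Nat.cast_nonneg _
  have k1 : w₁ * w₂ * ((min r₁ r₂ : ℕ) : ℝ) ≤ w₁ * w₂ * r₁ := mul_le_mul_of_nonneg_left hmin1 hw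
  have k2 : w₁ * w₂ * ((min r₁ r₂ : ℕ) : ℝ) ≤ w₁ * w₂ * r₂ := mul_le_mul_of_nonneg_left hmin2 hw
  have k0 : 0 ≤ w₁ * w₂ * ((min r₁ r₂ : ℕ) : ℝ) := mul_nonneg hw hmin0
  have k3 : 0 ≤ w₁ * w₂ * r₁ := mul_nonneg hw hr1
  have k4 : 0 ≤ w₁ * w₂ * r₂ := mul_nonneg hw hr2
  split_ifs <;> first | (exfalso; omega) | nlinarith [k0, k1, k2, k3, k4]

/-- **(U) is preserved by series composition** of symmetric families with nonnegative weights. -/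
theorem uval_ser_nonneg {ι₁ ι₂ : Type*} [Fintype ι₁] [Fintype ι₂] {w₁ : ι₁ → ℝ} {r₁ b₁ : ι₁ → ℕ}
    {w₂ : ι₂ → ℝ} {r₂ b₂ : ι₂ → ℕ} (hw₁ : ∀ x, 0 ≤ w₁ x) (hw₂ : ∀ y, 0 ≤ w₂ y)
    (hs₁ : Symm w₁ r₁ b₁) (hs₂ : Symm w₂ r₂ b₂)
    (hU₁ : 0 ≤ uval w₁ r₁ b₁) (hU₂ : 0 ≤ uval w₂ r₂ b₂) :
    0 ≤ uval (fun p : ι₁ × ι₂ => w₁ p.1 * w₂ p.2) (fun p => min (r₁ p.1) (r₂ p.2))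
      (fun p => min (b₁ p.1) (b₂ p.2)) := by
  rw [uval_eq_uval' (symm_ser hs₁ hs₂)]
  rw [uval_eq_uval' hs₁] at hU₁
  rw [uval_eq_uval' hs₂] at hU₂
  -- the masses
  set B₁ := ∑ x, w₁ x * (if r₁ x = 1 ∧ 1 ≤ b₁ x then (1 : ℝ) else 0) with hB₁
  set B₂ := ∑ y, w₂ y * (if r₂ y = 1 ∧ 1 ≤ b₂ y then (1 : ℝ) else 0) with hB₂
  set A₁ := ∑ x, w₁ x * (if b₁ x = 0 ∧ 2 ≤ r₁ x then (r₁ x : ℝ) else 0) with hA₁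
  set A₂ := ∑ y, w₂ y * (if b₂ y = 0 ∧ 2 ≤ r₂ y then (r₂ y : ℝ) else 0) with hA₂
  set Q₁ := ∑ x, w₁ x * (if 1 ≤ b₁ x ∧ 2 ≤ r₁ x then (1 : ℝ) else 0) with hQ₁
  set Q₂ := ∑ y, w₂ y * (if 1 ≤ b₂ y ∧ 2 ≤ r₂ y then (1 : ℝ) else 0) with hQ₂
  set A₂' := ∑ y, w₂ y * (if b₂ y = 0 ∧ 2 ≤ r₂ y then (1 : ℝ) else 0) with hA₂'
  have hU₁' : A₁ ≤ B₁ := by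
    unfold uval' at hU₁
    simp only [mul_sub, Finset.sum_sub_distrib] at hU₁
    linarith
  have hU₂' : A₂ ≤ B₂ := by
    unfold uval' at hU₂
    simp only [mul_sub, Finset.sum_sub_distrib] at hU₂
    linarith
  have hB₁0 : 0 ≤ B₁ := Finset.sum_nonneg (fun x _ => mul_nonneg (hw₁ x) (by split_ifs <;> norm_num))
  have hB₂0 : 0 ≤ B₂ := Finset.sum_nonneg (fun y _ => mul_nonneg (hw₂ y) (by split_ifs <;> norm_num))
  have hA₁0 : 0 ≤ A₁ := Finset.sum_nonneg (fun x _ => mul_nonneg (hw₁ x) (by split_ifs <;> positivity))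
  have hQ₁0 : 0 ≤ Q₁ := Finset.sum_nonneg (fun x _ => mul_nonneg (hw₁ x) (by split_ifs <;> norm_num))
  have hQ₂0 : 0 ≤ Q₂ := Finset.sum_nonneg (fun y _ => mul_nonneg (hw₂ y) (by split_ifs <;> norm_num))
  have hA₂'0 : 0 ≤ A₂' := Finset.sum_nonneg (fun y _ => mul_nonneg (hw₂ y) (by split_ifs <;> norm_num))
  -- `2 A₂' ≤ A₂`
  have h2A : 2 * A₂' ≤ A₂ := by
    rw [hA₂', hA₂, Finset.mul_sum]
    refine Finset.sum_le_sum (fun y _ => ?_)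
    by_cases h : b₂ y = 0 ∧ 2 ≤ r₂ y
    · simp only [h, and_self, if_true]
      have : (2 : ℝ) ≤ r₂ y := by exact_mod_cast h.2
      nlinarith [hw₂ y]
    · simp [h]
  -- positive and negative parts
  unfold uval'
  rw [Fintype.sum_prod_type]
  simp only [mul_sub, Finset.sum_sub_distrib]
  have hpos : ∑ x, ∑ y, w₁ x * w₂ y * (if min (r₁ x) (r₂ y) = 1 ∧ 1 ≤ min (b₁ x) (b₂ y)
      then (1 : ℝ) else 0) = B₁ * B₂ + B₁ * Q₂ + Q₁ * B₂ := by
    rw [hB₁, hB₂, hQ₁, hQ₂, Finset.sum_mul_sum, Finset.sum_mul_sum, Finset.sum_mul_sum,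
      ← Finset.sum_add_distrib, ← Finset.sum_add_distrib]
    refine Finset.sum_congr rfl (fun x _ => ?_)
    rw [← Finset.sum_add_distrib, ← Finset.sum_add_distrib]
    refine Finset.sum_congr rfl (fun y _ => ?_)
    exact ser_pos_pointwise (w₁ x) (w₂ y) (r₁ x) (b₁ x) (r₂ y) (b₂ y)
  have hneg : ∑ x, ∑ y, w₁ x * w₂ y * (if min (b₁ x) (b₂ y) = 0 ∧ 2 ≤ min (r₁ x) (r₂ y)
      then ((min (r₁ x) (r₂ y) : ℕ) : ℝ) else 0) ≤ A₁ * Q₂ + Q₁ * A₂ + A₁ * A₂' := by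
    rw [hA₁, hA₂, hQ₁, hQ₂, hA₂', Finset.sum_mul_sum, Finset.sum_mul_sum, Finset.sum_mul_sum,
      ← Finset.sum_add_distrib, ← Finset.sum_add_distrib]
    refine Finset.sum_le_sum (fun x _ => ?_)
    rw [← Finset.sum_add_distrib, ← Finset.sum_add_distrib]
    refine Finset.sum_le_sum (fun y _ => ?_)
    exact ser_neg_pointwise (w₁ x) (w₂ y) (hw₁ x) (hw₂ y) (r₁ x) (b₁ x) (r₂ y) (b₂ y)
  rw [hpos]
  have e1 : A₁ * Q₂ ≤ B₁ * Q₂ := mul_le_mul_of_nonneg_right hU₁' hQ₂0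
  have e2 : Q₁ * A₂ ≤ Q₁ * B₂ := mul_le_mul_of_nonneg_left hU₂' hQ₁0
  have e3 : A₁ * A₂' ≤ B₁ * B₂ := by
    calc A₁ * A₂' ≤ B₁ * A₂' := mul_le_mul_of_nonneg_right hU₁' hA₂'0
      _ ≤ B₁ * B₂ := by
        apply mul_le_mul_of_nonneg_left _ hB₁0
        linarith
  linarith

/-! ### The class of series–parallel families -/

/-- A weighted two-colour state family: a finite index type with weights and the two levels. -/
structure Fam where
  /-- the index type (configurations) -/
  ι : Type
  /-- finiteness -/
  [inst : Fintype ι]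
  /-- the weights -/
  w : ι → ℝ
  /-- the red level -/
  r : ι → ℕ
  /-- the blue level -/
  b : ι → ℕ

/-- the parallel product (flows add) -/
def Fam.par (F G : Fam) : Fam :=
  @Fam.mk (F.ι × G.ι) (@instFintypeProd _ _ F.inst G.inst) (fun p => F.w p.1 * G.w p.2)
    (fun p => F.r p.1 + G.r p.2) (fun p => F.b p.1 + G.b p.2)

/-- the series product (flows take minima) -/
def Fam.ser (F G : Fam) : Fam :=
  @Fam.mk (F.ι × G.ι) (@instFintypeProd _ _ F.inst G.inst) (fun p => F.w p.1 * G.w p.2)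
    (fun p => min (F.r p.1) (G.r p.2)) (fun p => min (F.b p.1) (G.b p.2))

/-- `U` of a bundled family -/
def Fam.U (F : Fam) : ℝ := @uval F.ι F.inst F.w F.r F.b

/-- a free edge: blue `(0,1)` or red `(1,0)`, weight `1` each -/
def Fam.edge : Fam := ⟨Bool, fun _ => 1, fun x => if x then 1 else 0, fun x => if x then 0 else 1⟩

/-- a pinned edge: open in both colours, state `(1,1)` -/
def Fam.pin : Fam := ⟨Unit, fun _ => 1, fun _ => 1, fun _ => 1⟩

/-- an absent edge: state `(0,0)` -/
def Fam.absent : Fam := ⟨Unit, fun _ => 1, fun _ => 0, fun _ => 0⟩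

/-- `U` of a parallel product of bundled families -/
theorem Fam.U_par (F G : Fam) :
    (F.par G).U = F.U * @zval G.ι G.inst G.w G.r + @zval F.ι F.inst F.w F.r * G.U :=
  @uval_par F.ι G.ι F.inst G.inst F.w F.r F.b G.w G.r G.b

/-- `U` of a series product of bundled symmetric families with nonnegative weights -/
theorem Fam.U_ser_nonneg (F G : Fam) (hF : ∀ x, 0 ≤ F.w x) (hG : ∀ y, 0 ≤ G.w y)
    (sF : @Symm F.ι F.w F.r F.b) (sG : @Symm G.ι G.w G.r G.b)
    (uF : 0 ≤ F.U) (uG : 0 ≤ G.U) : 0 ≤ (F.ser G).U :=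
  @uval_ser_nonneg F.ι G.ι F.inst G.inst F.w F.r F.b G.w G.r G.b hF hG sF sG uF uG

/-- series–parallel terms over the three atoms -/
inductive SP
  /-- a free edge -/
  | edge : SP
  /-- a pinned edge -/
  | pin : SP
  /-- an absent edge -/
  | absent : SP
  /-- parallel composition -/
  | par : SP → SP → SP
  /-- series composition -/
  | ser : SP → SP → SP

/-- the weighted state family of a series–parallel term -/
def SP.toFam : SP → Fam
  | .edge => Fam.edge
  | .pin => Fam.pin
  | .absent => Fam.absent
  | .par a c => (a.toFam).par (c.toFam)
  | .ser a c => (a.toFam).ser (c.toFam)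

/-- series–parallel families have nonnegative weights -/
theorem SP.w_nonneg : ∀ t : SP, ∀ x, 0 ≤ t.toFam.w x
  | .edge, x => by simp [SP.toFam, Fam.edge]
  | .pin, x => by simp [SP.toFam, Fam.pin]
  | .absent, x => by simp [SP.toFam, Fam.absent]
  | .par a c, p => mul_nonneg (SP.w_nonneg a p.1) (SP.w_nonneg c p.2)
  | .ser a c, p => mul_nonneg (SP.w_nonneg a p.1) (SP.w_nonneg c p.2)

/-- the colour swap of the free edge -/
def boolSwap : Bool ≃ Bool := ⟨not, not, Bool.not_not, Bool.not_not⟩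

/-- series–parallel families are colour-swap symmetric -/
theorem SP.symm : ∀ t : SP, @Symm t.toFam.ι t.toFam.w t.toFam.r t.toFam.b
  | .edge => ⟨boolSwap, fun x => by cases x <;> exact ⟨rfl, rfl, rfl⟩⟩
  | .pin => ⟨Equiv.refl _, fun _ => ⟨rfl, rfl, rfl⟩⟩
  | .absent => ⟨Equiv.refl _, fun _ => ⟨rfl, rfl, rfl⟩⟩
  | .par a c => @symm_par _ _ a.toFam.inst c.toFam.inst _ _ _ _ _ _ (SP.symm a) (SP.symm c)
  | .ser a c => @symm_ser _ _ a.toFam.inst c.toFam.inst _ _ _ _ _ _ (SP.symm a) (SP.symm c)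

/-- the value of `Z` is nonnegative for nonnegative weights -/
theorem zval_nonneg {w : ι → ℝ} {r : ι → ℕ} (hw : ∀ x, 0 ≤ w x) : 0 ≤ zval w r :=
  Finset.sum_nonneg (fun x _ => mul_nonneg (hw x) (by split_ifs <;> norm_num))

/-- **(U) holds for every series–parallel family**, in particular for the uniform two-colouring of
every pattern of every series–parallel two-terminal network. -/
theorem SP.uval_nonneg : ∀ t : SP, 0 ≤ t.toFam.U
  | .edge => by simp [SP.toFam, Fam.U, uval, Fam.edge]
  | .pin => by simp [SP.toFam, Fam.U, uval, Fam.pin]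
  | .absent => by simp [SP.toFam, Fam.U, uval, Fam.absent]
  | .par a c => by
    have ih₁ := SP.uval_nonneg a
    have ih₂ := SP.uval_nonneg c
    show 0 ≤ ((a.toFam).par (c.toFam)).U
    rw [Fam.U_par]
    exact add_nonneg (mul_nonneg ih₁ (@zval_nonneg _ c.toFam.inst _ _ (SP.w_nonneg c)))
      (mul_nonneg (@zval_nonneg _ a.toFam.inst _ _ (SP.w_nonneg a)) ih₂)
  | .ser a c => by
    have ih₁ := SP.uval_nonneg a
    have ih₂ := SP.uval_nonneg c
    show 0 ≤ ((a.toFam).ser (c.toFam)).U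
    exact Fam.U_ser_nonneg _ _ (SP.w_nonneg a) (SP.w_nonneg c) (SP.symm a) (SP.symm c) ih₁ ih₂

end FlowSum

end Summit.Ventures.PercRepro2
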